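import Literature.AnabelianGeometry.EtaleTheta.Discharge.Sec3Cor38iiiWeakPiNatInstance
import Literature.AnabelianGeometry.EtaleTheta.Discharge.Sec3Cor38iiWeakOfRatSupport
import Literature.AnabelianGeometry.EtaleTheta.Discharge.Sec3Cor38iiSelfEquivalenceWeak
import Literature.AnabelianGeometry.EtaleTheta.Discharge.Sec3Cor38iToyGenuine
import Literature.AnabelianGeometry.EtaleTheta.Discharge.Sec3WeakColumnOfProp34Const
import Literature.AnabelianGeometry.EtaleTheta.Discharge.Sec3Prop34CnstOfRlfZWeak
import Literature.AlgebraicGeometry.Frobenioids.PerfFactorialWeakGroupSaturated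
import HarnessLib

/-!
# [EtTh] Corollary 3.8 (i) and (ii) AS TYPED hold OUTRIGHT at the weak-vocabulary tempered Frobenioid with
# INFINITELY many special-fibre components — every print-level input of the weak node closers CHECKED at
# `WeakPiNat.genuineTemperedFrobenioid`, and Cor. 3.8 (i) ∧ (ii) ∧ (iii) with no binder there

S. Mochizuki, *The étale theta function and its Frobenioid-theoretic manifestations*, Publ. RIMS **45** (2009),
Cor. 3.8 (i)–(iii), statement PDF p. 80, proof pp. 81–82 [cite: MochizukiEtTh2009, Cor 3.8 p.80]; Def. 3.3 (iii)
p. 73, Rmk. 3.3.1 p. 73, Prop. 3.4 (i)/(ii) p. 74, Def. 3.6 (i)/(ii) pp. 76–77, Rmk. 3.6.3 p. 79; S. Mochizuki,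
*The geometry of Frobenioids I* (2008), §0 p. 10 (monoid types), Def. 2.4 (i) pp. 47–48, Thm. 5.2 (ii) p. 100
[cite: MochizukiFrdI2008, Def. 2.4(i) p.47].

abc-iut cell, layer L2, cone nodes `EtTh:Cor3.8(i)` / `EtTh:Cor3.8(ii)` (kernel ids `N_EtTh_Cor3_8_i`,
`N_EtTh_Cor3_8_ii`), row «COR38(i)(ii)-NV@WeakPiNat», seat abc-iut-L2-d2 (gen 5).  PROOF-ONLY (0 definitions)
instantiation witness — the WEAK-vocabulary, infinitely-many-components twin of abc-iut-w6-d039's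
`Discharge/Sec3Cor38iToyGenuine.lean` and abc-iut-w6-d040's `Discharge/Sec3Cor38iiToyGenuine.lean` (`Φ₀ = ℤ_{≥0}`,
ONE prime, strong vocabulary), and the (i)/(ii) companion of this seat's `Discharge/Sec3Cor38iiiWeakPiNatInstance.lean`
(p442078: Cor. 3.8 (iii) fires with no binder at the same witness).

THE WITNESS.  `C := WeakPiNat.genuineTemperedFrobenioid R S` (`TemperedFrobenioidGenuineWeakPiNat.lean`, p441924):
the Def. 3.6 (ii) tempered Frobenioid over the CONSTRUCTED weak Def. 3.6 (i) data
`RealifiedDivisorMonoids.ofRlfZWeak WeakPiNat.divisorMonoids _` (abc-iut-L6-t12) at the Def. 3.3 (iii) datum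
`Φ₀ := ∏_ℕ ℤ_{≥0}` (countably many special-fibre components — NOT perf-factorial as printed, cell finding F-L2d2-1,
so that the printed-vocabulary interface `ofRlfZ` is EMPTY there), `B₀ := ϖ^ℤ`, `div₀(ϖ) := d = (1, 1, …)`,
`F₀ := B₀`, with `Φ := im(Φ₀^pf → Φ₀^rlf)`, over the GENUINE weak monoid vocabulary `treeMonoidVocabWeak` and the
genuine category vocabulary `treeCatVocab`.

THE CLOSERS.  abc-iut-w6-d039's `Cor38Hyp.cor38_i_ofRlfZWeak_of_structural` (p439836) and abc-iut-L1-t12's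
`Cor38Hyp.cor38_ii_ofRlfZWeak_of_structural` (`Sec3Cor38iiWeakOfRatSupport.lean`) close the two nodes AS TYPED
over `ofRlfZWeak` data from NAMED `B₀`/`Φ₀`/`D`-level print clauses only, per side:

  `hB₀inj` (pull-backs of `B₀` injective) · `hFSM` (FSM-morphisms of `D` are isomorphisms) · `dm.Prop34` (the typed
  Prop. 3.4 structure) · [`hF₀inv` (`F₀(Y) ≅ L^×` inverse-closed) — (ii) only] · `hcyc` (divisors of constants are
  powers of one effective divisor) · `hZQ` (Rmk. 3.3.1: the primes of `Φ₀(Y)` are `ℤ`- or `ℚ`-primes) · `hsat` (rational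
  support of `Φ(W)` in `Φ₀(Y_W)^rlf`).

THIS FILE checks EVERY ONE of them at the witness — `hB₀inj_divisorMonoids` (`B₀` constant functor); `hFSM` :=
abc-iut-w6-d040's `Toy.hFSM_discretePUnit` BY NAME; **`prop34_divisorMonoids` — the typed Prop. 3.4 structure over
the GENUINE weak vocabularies `treeMonoidVocabWeak` / `treeCatVocab`** (`Φ₀(Y) = ∏_ℕ ℤ_{≥0}` IS weakly perf-factorial
with cofinal perfection, abc-iut-L2-d2's `PiNat.isPerfFactorialCof`; identity endomorphisms non-dilating; a
divisorial monoid on the one-object base); `hF₀inv`, `hcyc` := the fields of this seat's `prop34Const_divisorMonoids`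
(p442078); **`isZQMonoprime_primes_Φ₀` — every prime component `(∏_ℕ ℤ_{≥0})_𝔭 ≅ ℤ_{≥0}` is `ℤ`-monoprime**
(`PiNat.isZMonoprime_submonoid_prime`, one prime per component); `ratSupport_genuineTemperedFrobenioid` (`ι(a)^n =
ι(c)` for `a = c^{1/n}`) — and runs both compositions END-TO-END:

* §2 derived clauses OUTRIGHT at the witness: `prop34Cnst₀_divisorMonoids`, **`prop34Cnst_realified`** (abc-iut-L2-t3's
  Prop. 3.4 (ii)-relative-to-`D^cnst` structure for the `Λ = ℤ` realified data, by `Prop34Cnst.ofRlfZWeak`),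
  **`hQ_genuineTemperedFrobenioid`** (the binder `hQ` of row C38-L05 = abc-iut-L2-t3's census predicate `PfAtQ`,
  GAP G-w4d084-3: every `Φ(W)^pf_𝔮` is `ℚ`-monoprime — abc-iut-L6-t12's `hQ_ofRlfZWeak_of_ratSupport`),
  `exists_cnstFn_effective_…` (`hNZ`, Def. 3.6 (ii)(b) bracketed sentence), `remark363_…` (Rmk. 3.6.3),
  **`bsFldPreStepLimitCriterion_…`** (row C38-L05 itself);
* §3 **`cor38_i_genuineTemperedFrobenioid (h : Cor38Hyp C C') : Cor38_i IsFrobeniusSlim h`** and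
  **`preservesBaseFieldTheoretic_genuineTemperedFrobenioid h`** (the one-object base is slim, abc-iut-L1's
  `isSlim_discretePUnit`, hence Frobenius-slim — the hypothesis of (i) is met, so its CONCLUSION holds);
* §4 **`cor38_ii_genuineTemperedFrobenioid (h) : Cor38_ii (Def. 4.5 (iv)) h`**, **`cor38_ii_conclusion_…`** (the
  vocabulary parameter holds at the base, abc-iut-w6-d040's `Toy.isDivSlim45iv_discretePUnit`) and
  `hull_selfEquivalence_…` (every self-equivalence lifts compatibly to the real hull, abc-iut-L1-t12's
  `hull_selfEquivalence_ofRlfZWeak`);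
* §5 **`cor38_genuineTemperedFrobenioid (h) : Cor38_i … h ∧ Cor38_ii … h ∧ Cor38_iii h`** and its conclusion form —
  [EtTh] Cor. 3.8 (i), (ii), (iii) AS TYPED fire SIMULTANEOUSLY with NO binder beyond the standing-hypotheses
  structure `h`, for every `h`, at a tempered Frobenioid with infinitely many special-fibre components; `exists_…`
  with this seat's inhabitant `nonempty_cor38Hyp` (`Ψ := 𝟭`).

HONEST LABEL: a consistency / instantiation certificate at DEGENERATE geometry (one object, no cusps, all functions
constant, `Λ = ℤ`) over GENUINE vocabularies; it shows that the print-level hypothesis lists of the weak (i)/(ii)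
node closers are jointly satisfiable together with `Cor38Hyp` over constructed `ofRlfZWeak` data with infinitely
many primes — exactly the F-L2d2-1 regime the cell's weak §3 chain was built for — and that the compositions fire;
nothing more.  NOT the tempered Frobenioid of a curve; refereed pre-IUT material; nothing here bears on [IUTchIII]
Cor. 3.12; no side taken; typed ≠ proved.
-/

noncomputable section

namespace Literature.AnabelianGeometry.EtaleTheta

open CategoryTheory Opposite Function Literature.AlgebraicGeometry.Frobenioids

namespace WeakPiNat

/-! ## §1 The print-level input clauses at the Def. 3.3 (iii) datum `Φ₀ = ∏_ℕ ℤ_{≥0}`, `B₀ = F₀ = ϖ^ℤ` -/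

/-- (hB₀inj) for `WeakPiNat.divisorMonoids`: `B₀ = ϖ^ℤ` is a constant functor on the one-object base, so every
pull-back of `B₀` is the identity, injective ("the function field of a connected covering embeds in that of a
covering above it", Def. 3.3 (iii)). [cite: MochizukiEtTh2009, Def 3.3 p.73] -/
theorem hB₀inj_divisorMonoids {Y Y' : (Discrete PUnit.{1})ᵒᵖ} (g : Y ⟶ Y') :
    Injective (WeakPiNat.divisorMonoids.B₀.map g).hom := by
  change Injective (𝟙 (CommMonCat.of (Multiplicative ℤ)) : CommMonCat.of (Multiplicative ℤ) ⟶ _).hom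
  rw [CommMonCat.hom_id]
  exact injective_id

variable (R S : ((Discrete PUnit.{1})ᵒᵖ ⥤ CommMonCat.{0}) → Prop)

/-- **The typed [EtTh] Prop. 3.4 structure HOLDS for the datum over the GENUINE weak vocabularies**
`treeMonoidVocabWeak` (perf-factorial := weakly perf-factorial with cofinal perfection) and `treeCatVocab`: (i)
`Φ₀(Y) = ∏_ℕ ℤ_{≥0}` is weakly perf-factorial with cofinal perfection (abc-iut-L2-d2's `PiNat.isPerfFactorialCof` —
although NOT perf-factorial as printed, F-L2d2-1); the endomorphisms of `Φ₀(Y)` induced by endomorphisms of `Y`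
(identities) are non-dilating; `Φ₀` is a divisorial monoid on the one-object base ([FrdI] Def. 1.1); (ii) all
functions are constant (`F₀ = B₀`), so both effective-locus clauses hold. [cite: MochizukiEtTh2009, Prop 3.4 p.74] -/
theorem prop34_divisorMonoids :
    WeakPiNat.divisorMonoids.Prop34 treeMonoidVocabWeak.{0} (treeCatVocab (Discrete PUnit.{1}) R S) where
  isPerfFactorial Y := isPerfFactorialCof_Φ₀ Y
  isNonDilating Y f := by
    rw [treeMonoidVocabWeak_isNonDilating]
    change IsNonDilating (CommMonCat.Hom.hom (𝟙 (CommMonCat.of (Multiplicative (ℕ → ℕ)))))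
    rw [CommMonCat.hom_id]
    exact Example39NV.isNonDilating_id
  isDivisorialOn := by
    rw [treeCatVocab_isDivisorialOn]
    exact ⟨Cor38Toy.isMonoidOn_of_punit _, fun _ => PiNat.isDivisorial⟩
  ker_div₀_le_F₀ _ _ _ := trivial
  mem_F₀_of_div₀_mem _ _ _ _ := trivial

/-- **(hZQ) — [EtTh] Rmk. 3.3.1 — HOLDS for the datum**: every prime component `(∏_ℕ ℤ_{≥0})_𝔭` of `Φ₀(Y)` is
`ℤ`-monoprime (`≅ ℤ_{≥0}`, one prime per special-fibre component: abc-iut-L2-d2's `PiNat.isZMonoprime_submonoid_prime`).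
[cite: MochizukiEtTh2009, Rmk 3.3.1 p.73] -/
theorem isZQMonoprime_primes_Φ₀ (Y : (Discrete PUnit.{1})ᵒᵖ) (𝔭 : Primes (WeakPiNat.divisorMonoids.Φ₀.obj Y)) :
    IsZMonoprime ↥𝔭.submonoid ∨ IsQMonoprime ↥𝔭.submonoid :=
  Or.inl (PiNat.isZMonoprime_submonoid_prime (J := ℕ) 𝔭)

/-- **(hsat) — rational support — HOLDS at the witness**: every divisor `x ∈ Φ(W) = im(Φ₀^pf → Φ₀^rlf)` has a power
in the image of `Φ₀(Y_W)` (`x = ι(c^{1/n})` gives `x^n = ι(c)`; Def. 3.6 (i)/(ii) for monoid type `ℤ`).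
[cite: MochizukiEtTh2009, Def 3.6 p.76] -/
theorem ratSupport_genuineTemperedFrobenioid (W : Discrete PUnit.{1}) :
    ∀ x ∈ (WeakPiNat.genuineTemperedFrobenioid R S).Φ.carrier (op W),
      ∃ (N : ℕ+) (d : WeakPiNat.divisorMonoids.Φ₀.obj ((WeakPiNat.genuineTemperedFrobenioid R S).baseOp (op W))),
        x ^ (N : ℕ) = (isPerfFactorialCof_Φ₀ ((WeakPiNat.genuineTemperedFrobenioid R S).baseOp (op W))).weak.toRealification
          (Perfection.of _ d) := by
  rintro x ⟨a, rfl⟩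
  obtain ⟨⟨c, n⟩, rfl⟩ := Perfection.mk_surjective a
  refine ⟨n, c, ?_⟩
  change (isPerfFactorialCof_Φ₀ _).weak.toRealification (Perfection.mk c n) ^ (n : ℕ) =
    (isPerfFactorialCof_Φ₀ _).weak.toRealification (Perfection.of _ c)
  rw [← map_pow, Perfection.mk_pow_self]

/-! ## §2 Derived clauses OUTRIGHT at the witness: `Prop34Cnst₀`, `Prop34Cnst`, `hQ`, `hNZ`, Rmk. 3.6.3, C38-L05 -/

/-- **The typed `B₀`-level Prop. 3.4 (ii)-relative-to-`D^cnst` structure `Prop34Cnst₀` HOLDS for the datum**, with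
`cnst := 𝟭` (one object: `Y^cnst = Y`): the naturality and faithfulness clauses are vacuous on a one-object base
with only identity morphisms. [cite: MochizukiEtTh2009, Prop 3.4 (ii) p.74] -/
theorem prop34Cnst₀_divisorMonoids : WeakPiNat.divisorMonoids.Prop34Cnst₀ (𝟭 (Discrete PUnit.{1})) where
  B₀_map_eq_of_cnst_map_eq g g' _ b _ := by rw [Subsingleton.elim g g']
  Φ₀_map_eq_of_cnst_map_eq g g' _ x _ := by rw [Subsingleton.elim g g']
  cnst_map_eq_of_B₀_map_eq g g' _ := by rw [Subsingleton.elim g.hom g'.hom]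

/-- **abc-iut-L2-t3's Prop. 3.4 (ii)-relative-to-`D^cnst` structure `Prop34Cnst` HOLDS for the weak realified data
`WeakPiNat.realified = ofRlfZWeak divisorMonoids _`** (monoid type `ℤ`, `cnst := 𝟭`) — by abc-iut-L6-t12's transport
`Prop34Cnst.ofRlfZWeak` from `Prop34 ✓` and `Prop34Cnst₀ ✓`. [cite: MochizukiEtTh2009, Prop 3.4 (ii) p.74] -/
theorem prop34Cnst_realified : WeakPiNat.realified.Prop34Cnst (𝟭 (Discrete PUnit.{1})) :=
  RealifiedDivisorMonoids.Prop34Cnst.ofRlfZWeak (prop34_divisorMonoids (fun _ => True) fun _ => True)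
    prop34Cnst₀_divisorMonoids

/-- **`hQ` OUTRIGHT at the witness (GAP G-w4d084-3 / census A7 `PfAtQ` DISCHARGED at a model with infinitely many
primes)**: every localized perfection `Φ(W)^pf_𝔮` of the divisor monoid `Φ(W) = ι((∏_ℕ ℤ_{≥0})^pf)` is `ℚ`-monoprime —
abc-iut-L6-t12's `hQ_ofRlfZWeak_of_ratSupport` with (hZQ), (hsat) CHECKED. [cite: MochizukiEtTh2009, Def 3.6 p.77] -/
theorem hQ_genuineTemperedFrobenioid (W : Discrete PUnit.{1})
    (𝔮 : Primes (Perfection ((WeakPiNat.genuineTemperedFrobenioid R S).divisorMonoid.obj (op W)))) :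
    IsQMonoprime (PfAt ((WeakPiNat.genuineTemperedFrobenioid R S).divisorMonoid.obj (op W)) 𝔮) :=
  (WeakPiNat.genuineTemperedFrobenioid R S).hQ_ofRlfZWeak_of_ratSupport W (fun 𝔭 => isZQMonoprime_primes_Φ₀ _ 𝔭)
    (ratSupport_genuineTemperedFrobenioid R S W) 𝔮

/-- **`hNZ` — Def. 3.6 (ii)(b), bracketed sentence ("the image of `F(A) → (Φ^{bs-fld})^gp(A)` contains a nonzero
element of `Φ^{bs-fld}(A)`") — OUTRIGHT at the witness**: abc-iut-L6-t12's `exists_cnstFn_effective_ofRlfZWeak_of_prop34Const`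
with this seat's `prop34Const_divisorMonoids` (the element `(ϖ, [ι(d)])`). [cite: MochizukiEtTh2009, Def 3.6 p.77] -/
theorem exists_cnstFn_effective_genuineTemperedFrobenioid (A : (Discrete PUnit.{1})ᵒᵖ) :
    ∃ u : (WeakPiNat.realified.BΛ.obj ((WeakPiNat.genuineTemperedFrobenioid R S).baseOp A) : Type) ×
        Algebra.GrothendieckGroup ((WeakPiNat.genuineTemperedFrobenioid R S).Φ.carrier A),
      u ∈ (WeakPiNat.genuineTemperedFrobenioid R S).cnstFn A ∧
        ∃ Z : (WeakPiNat.genuineTemperedFrobenioid R S).Φ.carrier A, Z ≠ 1 ∧ u.2 = Algebra.GrothendieckGroup.of Z :=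
  (WeakPiNat.genuineTemperedFrobenioid R S).exists_cnstFn_effective_ofRlfZWeak_of_prop34Const prop34Const_divisorMonoids A

/-- **[EtTh] Rmk. 3.6.3 OUTRIGHT at the witness** (abc-iut-L6-t12's `remark363_ofRlfZWeak`, `Prop34 ✓`, `hF₀inv ✓`).
[cite: MochizukiEtTh2009, Rmk 3.6.3 p.79] -/
theorem remark363_genuineTemperedFrobenioid : (WeakPiNat.genuineTemperedFrobenioid R S).Remark363 :=
  (WeakPiNat.genuineTemperedFrobenioid R S).remark363_ofRlfZWeak (prop34_divisorMonoids R S) prop34Const_divisorMonoids.hF₀inv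

/-- **Row C38-L05 of the Cor. 3.8 sub-DAG (the base-field-theoretic pre-step criterion at THE perfection) OUTRIGHT at
the witness**, for the perfection attached to this seat's Frobenioid certificate `isFrobenioid_genuineTemperedFrobenioid`
— abc-iut-L6-t12's `bsFldPreStepLimitCriterion_ofRlfZWeak_of_ratSupport_of_prop34Const` with `Prop34 ✓`,
`Prop34Const ✓`, `hZQ ✓`, `hsat ✓`. [cite: MochizukiEtTh2009, Cor 3.8 p.81] -/
theorem bsFldPreStepLimitCriterion_genuineTemperedFrobenioid :
    (WeakPiNat.genuineTemperedFrobenioid R S).BsFldPreStepLimitCriterion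
      (PreFrobenioidData.perfection (isFrobenioid_genuineTemperedFrobenioid R S)) :=
  (WeakPiNat.genuineTemperedFrobenioid R S).bsFldPreStepLimitCriterion_ofRlfZWeak_of_ratSupport_of_prop34Const
    (isFrobenioid_genuineTemperedFrobenioid R S) (prop34_divisorMonoids R S) prop34Const_divisorMonoids
    (fun _ 𝔭 => isZQMonoprime_primes_Φ₀ _ 𝔭) (ratSupport_genuineTemperedFrobenioid R S)

/-! ## §3 [EtTh] Cor. 3.8 (i) AS TYPED, and its conclusion, with no binder at the witness -/

variable (R' S' : ((Discrete PUnit.{1})ᵒᵖ ⥤ CommMonCat.{0}) → Prop)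

/-- **[EtTh] Cor. 3.8 (i) AS TYPED (abc-iut-L2-t3's `Cor38_i`, vocabulary parameter := L1's `IsFrobeniusSlim`) holds
with NO hypothesis for EVERY Cor. 3.8 datum `h` between two weak-vocabulary witnesses at `Φ₀ = ∏_ℕ ℤ_{≥0}`** — abc-iut-w6-d039's
node closer `Cor38Hyp.cor38_i_ofRlfZWeak_of_structural` with its whole input list (`hB₀inj`, `hFSM`, `Prop34`, `hcyc`,
`hZQ`, `hsat` per side) CHECKED at the witness and the composition run end-to-end.
[cite: MochizukiEtTh2009, Cor 3.8 p.80] -/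
theorem cor38_i_genuineTemperedFrobenioid
    (h : Cor38Hyp (WeakPiNat.genuineTemperedFrobenioid R S) (WeakPiNat.genuineTemperedFrobenioid R' S')) :
    Literature.AnabelianGeometry.EtaleTheta.Cor38_i
      (fun E _ => Literature.AlgebraicGeometry.Frobenioids.IsFrobeniusSlim E) h :=
  h.cor38_i_ofRlfZWeak_of_structural (fun g => hB₀inj_divisorMonoids g) (fun α hα => Toy.hFSM_discretePUnit α hα)
    (prop34_divisorMonoids R S) prop34Const_divisorMonoids.hcyc (fun _ 𝔭 => isZQMonoprime_primes_Φ₀ _ 𝔭)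
    (ratSupport_genuineTemperedFrobenioid R S) (fun g => hB₀inj_divisorMonoids g)
    (fun α hα => Toy.hFSM_discretePUnit α hα) (prop34_divisorMonoids R' S') prop34Const_divisorMonoids.hcyc
    (fun _ 𝔭 => isZQMonoprime_primes_Φ₀ _ 𝔭) (ratSupport_genuineTemperedFrobenioid R' S')

/-- **The CONCLUSION of [EtTh] Cor. 3.8 (i) — "`Ψ` preserves the base-field-theoretic morphisms" — holds OUTRIGHT at
the witness, for every `h`**: the one-object base `Discrete PUnit` is slim (abc-iut-L1's `isSlim_discretePUnit`), hence
Frobenius-slim ([FrdI] §0), which is the hypothesis of (i). [cite: MochizukiEtTh2009, Cor 3.8 p.80] -/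
theorem preservesBaseFieldTheoretic_genuineTemperedFrobenioid
    (h : Cor38Hyp (WeakPiNat.genuineTemperedFrobenioid R S) (WeakPiNat.genuineTemperedFrobenioid R' S')) :
    Literature.AnabelianGeometry.EtaleTheta.PreservesBaseFieldTheoretic h :=
  cor38_i_genuineTemperedFrobenioid R S R' S' h isSlim_discretePUnit.isFrobeniusSlim
    isSlim_discretePUnit.isFrobeniusSlim

/-! ## §4 [EtTh] Cor. 3.8 (ii) AS TYPED, its conclusion, and the hull lift of every self-equivalence -/

/-- **[EtTh] Cor. 3.8 (ii) AS TYPED (abc-iut-L2-t3's `Cor38_ii`, vocabulary parameter := [FrdI] Def. 4.5 (iv) "Div-slim")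
holds with NO hypothesis for EVERY Cor. 3.8 datum `h` between two weak-vocabulary witnesses at `Φ₀ = ∏_ℕ ℤ_{≥0}`** —
abc-iut-L1-t12's node closer `Cor38Hyp.cor38_ii_ofRlfZWeak_of_structural` with its whole input list (`hB₀inj`, `hFSM`,
`Prop34`, `hF₀inv`, `hcyc`, `hZQ`, `hsat` per side) CHECKED at the witness and the composition run end-to-end.
[cite: MochizukiEtTh2009, Cor 3.8 p.81] -/
theorem cor38_ii_genuineTemperedFrobenioid
    (h : Cor38Hyp (WeakPiNat.genuineTemperedFrobenioid R S) (WeakPiNat.genuineTemperedFrobenioid R' S')) :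
    Literature.AnabelianGeometry.EtaleTheta.Cor38_ii
      (fun E _ Φ => ∀ (A : E) (α : Aut (Over.forget A)),
        (∀ (B : Over A) (x : Φ.obj (op B.left)),
          Literature.AlgebraicGeometry.Frobenioids.pull Φ (α.hom.app B) x = x) → α = 1) h :=
  h.cor38_ii_ofRlfZWeak_of_structural (fun g => hB₀inj_divisorMonoids g) (fun α hα => Toy.hFSM_discretePUnit α hα)
    (prop34_divisorMonoids R S) prop34Const_divisorMonoids.hF₀inv prop34Const_divisorMonoids.hcyc
    (fun _ 𝔭 => isZQMonoprime_primes_Φ₀ _ 𝔭) (ratSupport_genuineTemperedFrobenioid R S)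
    (fun g => hB₀inj_divisorMonoids g) (fun α hα => Toy.hFSM_discretePUnit α hα) (prop34_divisorMonoids R' S')
    prop34Const_divisorMonoids.hF₀inv prop34Const_divisorMonoids.hcyc (fun _ 𝔭 => isZQMonoprime_primes_Φ₀ _ 𝔭)
    (ratSupport_genuineTemperedFrobenioid R' S')

/-- **The CONCLUSION of [EtTh] Cor. 3.8 (ii) OUTRIGHT at the witness, for every `h`**: `Ψ` preserves the
base-field-theoretic morphisms AND induces a compatible equivalence `Ψbs` of the base-field-theoretic hulls
(`C^{bs-fld} → C ≅ C' ← C'^{bs-fld}`) — the antecedents "`D_i` Div-slim" ([FrdI] Def. 4.5 (iv)) holding at the one-object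
base (abc-iut-w6-d040's `Toy.isDivSlim45iv_discretePUnit`). [cite: MochizukiEtTh2009, Cor 3.8 p.81] -/
theorem cor38_ii_conclusion_genuineTemperedFrobenioid
    (h : Cor38Hyp (WeakPiNat.genuineTemperedFrobenioid R S) (WeakPiNat.genuineTemperedFrobenioid R' S')) :
    PreservesBaseFieldTheoretic h ∧
      ∃ Ψbs : (WeakPiNat.genuineTemperedFrobenioid R S).hullCategory ≌ (WeakPiNat.genuineTemperedFrobenioid R' S').hullCategory,
        Nonempty ((WeakPiNat.genuineTemperedFrobenioid R S).hull ⋙ h.Ψ.functor ≅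
          Ψbs.functor ⋙ (WeakPiNat.genuineTemperedFrobenioid R' S').hull) :=
  cor38_ii_genuineTemperedFrobenioid R S R' S' h (Toy.isDivSlim45iv_discretePUnit _)
    (Toy.isDivSlim45iv_discretePUnit _)

/-- **[EtTh] Cor. 3.8 (ii) for EVERY self-equivalence `e` of the witness** (no `Cor38Hyp` packaging left to the
reader): `e` preserves the base-field-theoretic morphisms and lifts compatibly to a self-equivalence of the real hull
category — abc-iut-L1-t12's `hull_selfEquivalence_ofRlfZWeak` with `D` of FSMFF-type ([FrdI] §0: FSM-type ⇒ FSMFF-type),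
`Φ` non-dilating (this seat's `genuineTemperedFrobenioid_nonDilating`), the base Div-slim, and the seven data-side
clauses CHECKED. [cite: MochizukiEtTh2009, Cor 3.8 p.81] -/
theorem hull_selfEquivalence_genuineTemperedFrobenioid
    (e : (WeakPiNat.genuineTemperedFrobenioid R S).category ≌ (WeakPiNat.genuineTemperedFrobenioid R S).category) :
    (∀ {A B : (WeakPiNat.genuineTemperedFrobenioid R S).category} (f : A ⟶ B),
        (WeakPiNat.genuineTemperedFrobenioid R S).IsBaseFieldTheoretic f ↔
          (WeakPiNat.genuineTemperedFrobenioid R S).IsBaseFieldTheoretic (e.functor.map f)) ∧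
      ∃ e' : (WeakPiNat.genuineTemperedFrobenioid R S).hullCategory ≌ (WeakPiNat.genuineTemperedFrobenioid R S).hullCategory,
        Nonempty ((WeakPiNat.genuineTemperedFrobenioid R S).hull ⋙ e.functor ≅ e'.functor ⋙ (WeakPiNat.genuineTemperedFrobenioid R S).hull) :=
  TemperedFrobenioid.hull_selfEquivalence_ofRlfZWeak (WeakPiNat.genuineTemperedFrobenioid R S)
    PadicFrd.isOfFSMType_discretePUnit.isOfFSMFFType (genuineTemperedFrobenioid_nonDilating R S)
    (Toy.isDivSlim45iv_discretePUnit _) (isFrobenioid_genuineTemperedFrobenioid R S) (prop34_divisorMonoids R S)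
    prop34Const_divisorMonoids.hF₀inv prop34Const_divisorMonoids.hcyc (fun _ 𝔭 => isZQMonoprime_primes_Φ₀ _ 𝔭)
    (ratSupport_genuineTemperedFrobenioid R S) e

/-! ## §5 [EtTh] Cor. 3.8 (i) ∧ (ii) ∧ (iii) simultaneously, with no binder, at infinitely many components -/

/-- **[EtTh] Cor. 3.8 (i), (ii) AND (iii) AS TYPED hold SIMULTANEOUSLY, with NO hypothesis beyond the standing-hypotheses
structure `h`, for every Cor. 3.8 datum `h` between two weak-vocabulary witnesses at `Φ₀ = ∏_ℕ ℤ_{≥0}`** — (i)/(ii) above,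
(iii) = this seat's `cor38_iii_genuineTemperedFrobenioid` (p442078).  The cell's weak [EtTh] §3 chain (abc-iut-L2-d2 /
L6-t12 / L2-t3 / L1-t12 / w6-d039 / w6-d040 / w4-d084 / w5-d124 / w5-d135 / f-038 lineages) is NON-VACUOUS, all three
parts at once, exactly in the F-L2d2-1 regime (infinitely many special-fibre components) it was built for.
[cite: MochizukiEtTh2009, Cor 3.8 p.80] -/
theorem cor38_genuineTemperedFrobenioid
    (h : Cor38Hyp (WeakPiNat.genuineTemperedFrobenioid R S) (WeakPiNat.genuineTemperedFrobenioid R' S')) :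
    Literature.AnabelianGeometry.EtaleTheta.Cor38_i
        (fun E _ => Literature.AlgebraicGeometry.Frobenioids.IsFrobeniusSlim E) h ∧
      Literature.AnabelianGeometry.EtaleTheta.Cor38_ii
        (fun E _ Φ => ∀ (A : E) (α : Aut (Over.forget A)),
          (∀ (B : Over A) (x : Φ.obj (op B.left)),
            Literature.AlgebraicGeometry.Frobenioids.pull Φ (α.hom.app B) x = x) → α = 1) h ∧
      Cor38_iii h :=
  ⟨cor38_i_genuineTemperedFrobenioid R S R' S' h, cor38_ii_genuineTemperedFrobenioid R S R' S' h,
    cor38_iii_genuineTemperedFrobenioid R S R' S' h⟩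

/-- **The CONCLUSIONS of [EtTh] Cor. 3.8 (i), (ii), (iii) simultaneously at the witness, for every `h`**: `Ψ` preserves
the base-field-theoretic morphisms, lifts compatibly to the base-field-theoretic hulls, and preserves the non-cuspidal
and cuspidal pre-steps. [cite: MochizukiEtTh2009, Cor 3.8 p.80] -/
theorem cor38_conclusion_genuineTemperedFrobenioid
    (h : Cor38Hyp (WeakPiNat.genuineTemperedFrobenioid R S) (WeakPiNat.genuineTemperedFrobenioid R' S')) :
    PreservesBaseFieldTheoretic h ∧
      (∃ Ψbs : (WeakPiNat.genuineTemperedFrobenioid R S).hullCategory ≌ (WeakPiNat.genuineTemperedFrobenioid R' S').hullCategory,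
        Nonempty ((WeakPiNat.genuineTemperedFrobenioid R S).hull ⋙ h.Ψ.functor ≅
          Ψbs.functor ⋙ (WeakPiNat.genuineTemperedFrobenioid R' S').hull)) ∧
      Cor38_iii h :=
  ⟨preservesBaseFieldTheoretic_genuineTemperedFrobenioid R S R' S' h,
    (cor38_ii_conclusion_genuineTemperedFrobenioid R S R' S' h).2, cor38_iii_genuineTemperedFrobenioid R S R' S' h⟩

/-- **The typed statements of the nodes `EtTh:Cor3.8(i)`, `(ii)`, `(iii)` have a SIMULTANEOUS unconditional kernel
instance at infinitely many special-fibre components**: with this seat's inhabitant of `Cor38Hyp` at the witness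
(`Ψ := 𝟭`, `nonempty_cor38Hyp`). [cite: MochizukiEtTh2009, Cor 3.8 p.80] -/
theorem exists_cor38Hyp_cor38 :
    ∃ h : Cor38Hyp (WeakPiNat.genuineTemperedFrobenioid R S) (WeakPiNat.genuineTemperedFrobenioid R S),
      Literature.AnabelianGeometry.EtaleTheta.Cor38_i
          (fun E _ => Literature.AlgebraicGeometry.Frobenioids.IsFrobeniusSlim E) h ∧
        Literature.AnabelianGeometry.EtaleTheta.Cor38_ii
          (fun E _ Φ => ∀ (A : E) (α : Aut (Over.forget A)),
            (∀ (B : Over A) (x : Φ.obj (op B.left)),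
              Literature.AlgebraicGeometry.Frobenioids.pull Φ (α.hom.app B) x = x) → α = 1) h ∧
        Cor38_iii h := by
  obtain ⟨h⟩ := nonempty_cor38Hyp R S
  exact ⟨h, cor38_genuineTemperedFrobenioid R S R S h⟩

/-- … and so have their conclusions. [cite: MochizukiEtTh2009, Cor 3.8 p.80] -/
theorem exists_cor38Hyp_cor38_conclusion :
    ∃ h : Cor38Hyp (WeakPiNat.genuineTemperedFrobenioid R S) (WeakPiNat.genuineTemperedFrobenioid R S),
      PreservesBaseFieldTheoretic h ∧
        (∃ Ψbs : (WeakPiNat.genuineTemperedFrobenioid R S).hullCategory ≌ (WeakPiNat.genuineTemperedFrobenioid R S).hullCategory,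
          Nonempty ((WeakPiNat.genuineTemperedFrobenioid R S).hull ⋙ h.Ψ.functor ≅
            Ψbs.functor ⋙ (WeakPiNat.genuineTemperedFrobenioid R S).hull)) ∧
        Cor38_iii h := by
  obtain ⟨h⟩ := nonempty_cor38Hyp R S
  exact ⟨h, cor38_conclusion_genuineTemperedFrobenioid R S R S h⟩

end WeakPiNat

end Literature.AnabelianGeometry.EtaleTheta

end
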